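import Summits.PneNP.PneNP.Theses.EcdlpDefinability
import Summits.PneNP.PneNP.Theorems.EcdlpDefinabilityEcdlpInNP
import Summits.PneNP.PneNP.Theorems.EcdlpDefinabilityLegendreFingerprint
import Literature.Computability.Cryptography.EcdlpLanguage
import Literature.Computability.Complexity.PNPWave0Proofs
import Literature.Computability.Complexity.ClayProblem
import Literature.Computability.Complexity.CircuitClassesUniformProofs
import Literature.Computability.Complexity.ProbabilisticClassesProofs
import Literature.Computability.Complexity.TimeSpaceChainProofs
import Literature.Computability.Complexity.ConstantDepth
import Literature.Computability.MetaComplexity.DistProblemsProofs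

/-!
# Strategy census — crux `EcdlpNotInP` (stmt-PneNP-2071): kernel-checked obstructions

Unit `cstrat-stmt-PneNP-2071-r1` (crux-strategist, route re-audit bin RESTATED), route
`route-PneNP-EcdlpDefinability`. Companion of `STRATEGY-CENSUS.md` (the prose audit, decomposition
shapes D1–D14) and `Probes.lean` (the BC2(c) cheap probes). Everything here is sorry-free.

X := `Summit.PneNP.PneNP.Theses.EcdlpDefinability.EcdlpNotInP` (= `EcdlpLanguage ∉ PNPWave0.P Bool`,
`ecdlpNotInP_iff`, `Iff.rfl`), S := `PneNP`.

* §O0 `pneNP_of_ecdlpNotInP : X → S` — one line over the LANDED `EcdlpInNP`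
  (`ecdlpDefinability_ecdlpInNP_proof`): the crux is at least the summit BY NAME (why it is RESTATED).
* §O1 hardness-import shape: `ecdlpNotInP_of_karpImport` (`Q ≤ₚ L_EC → Q ∉ P → X`, one line over
  the landed closure `mem_P_of_polyTimeReducible_holds`) and `pneNP_of_npImport` (`Q ∈ NP → Q ∉ P → S`):
  the hardness piece of any import is ≥ X once the reduction lands, and ≥ S outright when `Q ∈ NP`.
* §O2 the ¬S-consequence lemmas (`piece_ge_summit_of_coPiece`, `partner_ge_X_of_notX_consequence`,
  `pair_ge_summit_of_coPiece`): a piece implied by ¬S (resp. ¬X) forces its partner(s) to be ≥ S (resp. ≥ X).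
* §O3 the modus-ponens seam: `mp_seam` (restricted-model lower bound W + simulation B ⊢ X in ONE line),
  `simulation_iff` (B ⟺ X ∨ ¬W) and `simulation_iff_X_of_W` (given W, B IS X — costume).
* §O3' `ecdlpNotInP_iff_forall_not_mem_DTIME` (X ⟺ ∀ k, L_EC ∉ DTIME(n^k)) and `speedup_seam`.
* §O5 stronger pieces are ≥ X (and ≥ S) by one landed inclusion: `…_of_not_mem_PPoly` (P ⊆ P/poly),
  `…_of_not_mem_BPP` (P ⊆ BPP), `…_of_avgHard` ((P, D) ⊆ AvgP ⊆ HeurP), `…_of_not_mem_LOGSPACE` converse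
  direction (`not_mem_LOGSPACE_of_ecdlpNotInP`: W_L is a CONSEQUENCE of X).
* §O6 `legendreFingerprint_holds` — the landed dead-end lemma that killed oracle-genericity / capture.
* §O7 typed re-languagings: `EcdlpSearchInFP` (least-logarithm search function in FP),
  `EcdlpHalfLanguage` / `EcdlpHalfNotInP` (Blum–Micali half predicate), `EcdlpMembershipLanguage`
  (the `t = ∞` slice). They elaborate; their equivalence with X is two Turing-machine constructions each
  (binary search; Blum–Micali §3), deliberately NOT proved here — see the census, D8/D9.

References: [CookClay2006, §1, Prop. 1(a)]; [BlumMicali1984, §3]; [Miller1986ECC];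
[BogdanovTrevisan2006, §2.1]; [Adleman1978]; route file docstrings.
-/

set_option linter.dupNamespace false
set_option autoImplicit false

namespace Summit.PneNP.PneNP.Cruxes.EcdlpNotInP.StrategyCensus

open _root_.Computability
open Literature.Computability.Complexity Literature.Computability.Cryptography
open Literature.Computability.MetaComplexity
open Summit.PneNP.PneNP.Theses.EcdlpDefinability
open scoped Literature.Computability.Complexity.PNPWave0

/-! ## §O0 The crux by name; X ≥ S -/

/-- The crux is literally `EcdlpLanguage ∉ P` (the Literature definition is the route's term verbatim). [folklore] -/
theorem ecdlpNotInP_iff : EcdlpNotInP ↔ EcdlpLanguage ∉ PNPWave0.P Bool := Iff.rfl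

/-- **X ≥ S by name.** `EcdlpInNP` is proved in the tree, so the route's `closes` makes the crux imply the
summit in one line. Any conjunction of pieces proving X proves S. [cite: CookClay2006, §1] -/
theorem pneNP_of_ecdlpNotInP (hX : EcdlpNotInP) : PneNP :=
  closes Summit.PneNP.PneNP.Theorems.ecdlpDefinability_ecdlpInNP_proof hX

/-! ## §O1 Hardness-import shape -/

/-- **Karp import.** If a language `Q` (over any finite alphabet) Karp-reduces to `L_EC`, hardness of `Q`
ALONE gives X — over the landed closure of Cook's `P` under `≤ₚ`. So in `X ⇐ (Q ∉ P) ∧ (Q ≤ₚ L_EC)` the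
hardness piece is ≥ X the moment the reduction piece lands. [cite: CookClay2006, Proposition 1(a)] -/
theorem ecdlpNotInP_of_karpImport {Γ : Type} [Fintype Γ] {Q : Language Γ}
    (hred : Q ≤ₚ EcdlpLanguage) (hQ : Q ∉ PNPWave0.P Γ) : EcdlpNotInP :=
  fun hX => hQ (mem_P_of_polyTimeReducible_holds hred hX)

/-- … and therefore gives S. [cite: CookClay2006, Proposition 1(a)] -/
theorem pneNP_of_karpImport {Γ : Type} [Fintype Γ] {Q : Language Γ}
    (hred : Q ≤ₚ EcdlpLanguage) (hQ : Q ∉ PNPWave0.P Γ) : PneNP :=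
  pneNP_of_ecdlpNotInP (ecdlpNotInP_of_karpImport hred hQ)

/-- **NP import.** A hardness piece `Q ∉ P` for ANY `Q ∈ NP` is ≥ S with no reduction at all — and every
language Karp-reducible to `L_EC ∈ NP ∩ coNP` is such a `Q`. ECDLP has no hardness backstop below S. [cite: CookClay2006, §1] -/
theorem pneNP_of_npImport {Q : Language Bool} (hNP : Q ∈ PNPWave0.NP Bool) (hQ : Q ∉ PNPWave0.P Bool) :
    PneNP :=
  ⟨Q, hNP, hQ⟩

/-! ## §O2 The ¬S-consequence lemmas (pure logic over §O0) -/

/-- If the assembly `A → B → X` is proved and `A` is a consequence of `¬S`, then `B` alone is ≥ S. [folklore] -/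
theorem piece_ge_summit_of_coPiece {A B : Prop} (hasm : A → B → EcdlpNotInP) (hA : ¬ PneNP → A)
    (hB : B) : PneNP :=
  Classical.byContradiction fun hS => hS (pneNP_of_ecdlpNotInP (hasm (hA hS) hB))

/-- If `A` is a consequence of `¬X`, then its partner `B` is ≥ X: `A` is not load-bearing. [folklore] -/
theorem partner_ge_X_of_notX_consequence {A B : Prop} (hasm : A → B → EcdlpNotInP)
    (hA : ¬ EcdlpNotInP → A) (hB : B) : EcdlpNotInP :=
  Classical.byContradiction fun hX => hX (hasm (hA hX) hB)

/-- Three-piece version: the pair complementary to a `¬S`-consequence is jointly ≥ S. [folklore] -/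
theorem pair_ge_summit_of_coPiece {A B C : Prop} (hasm : A → B → C → EcdlpNotInP) (hA : ¬ PneNP → A)
    (hB : B) (hC : C) : PneNP :=
  Classical.byContradiction fun hS => hS (pneNP_of_ecdlpNotInP (hasm (hA hS) hB hC))

/-! ## §O3 The modus-ponens seam -/

/-- **The seam of every "restricted-model lower bound + simulation" split is one line.**
W := `L_EC ∉ 𝓜`, B := `L_EC ∈ P → L_EC ∈ 𝓜` ⊢ X. [folklore] -/
theorem mp_seam (𝓜 : Set (Language Bool)) (hW : EcdlpLanguage ∉ 𝓜)
    (hB : EcdlpLanguage ∈ PNPWave0.P Bool → EcdlpLanguage ∈ 𝓜) : EcdlpNotInP :=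
  fun hP => hW (hB hP)

/-- The simulation piece is `X ∨ ¬W` in disguise. [folklore] -/
theorem simulation_iff (𝓜 : Set (Language Bool)) :
    (EcdlpLanguage ∈ PNPWave0.P Bool → EcdlpLanguage ∈ 𝓜) ↔ (EcdlpNotInP ∨ EcdlpLanguage ∈ 𝓜) := by
  rw [ecdlpNotInP_iff]
  tauto

/-- … so GIVEN the restricted-model lower bound W, the simulation piece IS the crux (costume). [folklore] -/
theorem simulation_iff_X_of_W (𝓜 : Set (Language Bool)) (hW : EcdlpLanguage ∉ 𝓜) :
    (EcdlpLanguage ∈ PNPWave0.P Bool → EcdlpLanguage ∈ 𝓜) ↔ EcdlpNotInP := by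
  rw [simulation_iff]
  constructor
  · rintro (h | h)
    · exact h
    · exact absurd h hW
  · exact Or.inl

/-! ## §O3' Fixed-polynomial slicing -/

/-- X is the conjunction of the infinitely many strictly weaker slices `L_EC ∉ DTIME(n^k)`. [cite: AroraBarak2009, Def. 1.13] -/
theorem ecdlpNotInP_iff_forall_not_mem_DTIME :
    EcdlpNotInP ↔ ∀ k : ℕ, EcdlpLanguage ∉ DTIME (fun n => n ^ k) := by
  rw [ecdlpNotInP_iff, show PNPWave0.P Bool = Classes.P from P_bool_eq_holds]
  simp only [Classes.P, Set.mem_iUnion, not_exists]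

/-- Any finite truncation needs a speed-up piece, and then the seam is `mp_seam` again. [folklore] -/
theorem speedup_seam (k₀ : ℕ) (hW : EcdlpLanguage ∉ DTIME (fun n => n ^ k₀))
    (hB : EcdlpLanguage ∈ PNPWave0.P Bool → EcdlpLanguage ∈ DTIME (fun n => n ^ k₀)) : EcdlpNotInP :=
  mp_seam _ hW hB

/-! ## §O5 Stronger pieces are ≥ X (and ≥ S) by one landed inclusion -/

/-- Non-uniform hardness is ≥ X (`P ⊆ P/poly`, landed). [cite: AroraBarak2009, §6.1] -/
theorem ecdlpNotInP_of_not_mem_PPoly (h : EcdlpLanguage ∉ PPoly) : EcdlpNotInP := by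
  rw [ecdlpNotInP_iff, show PNPWave0.P Bool = Classes.P from P_bool_eq_holds]
  exact fun hP => h (P_subset_PPoly_holds hP)

/-- … and ≥ S. [cite: AroraBarak2009, §6.1] -/
theorem pneNP_of_not_mem_PPoly (h : EcdlpLanguage ∉ PPoly) : PneNP :=
  pneNP_of_ecdlpNotInP (ecdlpNotInP_of_not_mem_PPoly h)

/-- Randomised hardness is ≥ X (`P ⊆ BPP`, landed). [cite: AroraBarak2009, §7.1] -/
theorem ecdlpNotInP_of_not_mem_BPP (h : EcdlpLanguage ∉ BPP) : EcdlpNotInP := by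
  rw [ecdlpNotInP_iff, show PNPWave0.P Bool = Classes.P from P_bool_eq_holds]
  exact fun hP => h (P_subset_BPP_holds hP)

/-- … and ≥ S. [cite: AroraBarak2009, §7.1] -/
theorem pneNP_of_not_mem_BPP (h : EcdlpLanguage ∉ BPP) : PneNP :=
  pneNP_of_ecdlpNotInP (ecdlpNotInP_of_not_mem_BPP h)

/-- Average-case hardness (for ANY ensemble `D` of instances — e.g. uniform `Q` in `⟨P⟩` on uniform curves,
or uniform over an isogeny class) is ≥ X: `(P, D) ⊆ AvgP ⊆ HeurP`, both landed. [cite: BogdanovTrevisan2006, §2.1] -/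
theorem ecdlpNotInP_of_avgHard (D : Ensemble) (h : (⟨EcdlpLanguage, D⟩ : DistProblem) ∉ HeurP) :
    EcdlpNotInP := by
  rw [ecdlpNotInP_iff, show PNPWave0.P Bool = Classes.P from P_bool_eq_holds]
  intro hP
  exact h (AvgP_subset_HeurP_holds (distClass_P_subset_AvgP_holds ⟨hP, Set.mem_univ _⟩))

/-- … and ≥ S. [cite: BogdanovTrevisan2006, §2.1] -/
theorem pneNP_of_avgHard (D : Ensemble) (h : (⟨EcdlpLanguage, D⟩ : DistProblem) ∉ HeurP) : PneNP :=
  pneNP_of_ecdlpNotInP (ecdlpNotInP_of_avgHard D h)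

/-- Converse direction for a restricted class INSIDE P: `L_EC ∉ LOGSPACE` is a CONSEQUENCE of X
(`LOGSPACE ⊆ P`, landed) — a strictly weaker piece, with no proved way back except `mp_seam`. [cite: AroraBarak2009, §4.1] -/
theorem not_mem_LOGSPACE_of_ecdlpNotInP (hX : EcdlpNotInP) : EcdlpLanguage ∉ LOGSPACE := by
  rw [ecdlpNotInP_iff, show PNPWave0.P Bool = Classes.P from P_bool_eq_holds] at hX
  exact fun hL => hX (LOGSPACE_subset_P_holds hL)

/-- Likewise every fixed-polynomial slice is a consequence of X. [cite: AroraBarak2009, Def. 1.13] -/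
theorem not_mem_DTIME_of_ecdlpNotInP (hX : EcdlpNotInP) (k : ℕ) : EcdlpLanguage ∉ DTIME (fun n => n ^ k) :=
  (ecdlpNotInP_iff_forall_not_mem_DTIME.mp hX) k

/-! ## §O6 ECDLP-specific: the capture dead end is a landed theorem -/

/-- The Legendre-fingerprint lemma (support item stmt-PneNP-2077, PROVED): `3·log₂ p` queries of the single
bounded formula `∃ z, z·z = x + c` identify a hidden x-coordinate, so every information-theoretic
"generic group + bounded-definable oracle" model — the only model in which a simulation piece B for ECDLP was
ever proposed — is trivial. Recorded here as the reason D4's simulation pieces for 𝓜 = generic / definable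
algorithms are FALSE, not merely unproved. [cite: BonehLipton1996] -/
theorem legendreFingerprint_holds : LegendreFingerprint :=
  Summit.PneNP.PneNP.Theorems.ecdlp_legendreFingerprint_proof

/-! ## §O7 Typed re-languagings of X (they elaborate; equivalence with X = two TM constructions each) -/

/-- `EcdlpSearchInFP`: some polynomial-time string function maps the code of `(p, a₁,…,a₆, P, Q)` to the
code `[m]` of a logarithm `m ≤ t` whenever the instance with bound `t` is solvable (taking `t` = the least
logarithm forces `m` to be the least logarithm). `¬EcdlpSearchInFP ⟺ X`: binary search on `t` (decision ⇒
search) and "compute `m`, check `m ≤ t` and `m • P = Q` by double-and-add" (search ⇒ decision) — both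
Turing-machine constructions, neither a one-lemma step (census D8). [cite: Miller1986ECC, pp. 421–423] -/
def EcdlpSearchInFP : Prop :=
  ∃ f ∈ FP, ∀ p a₁ a₂ a₃ a₄ a₆ xp yp xq yq t : ℕ, EcdlpSolvable p a₁ a₂ a₃ a₄ a₆ xp yp xq yq t →
    ∃ m : ℕ, f (encodingListNatBool.encode [p, a₁, a₂, a₃, a₄, a₆, xp, yp, xq, yq]) =
        encodingListNatBool.encode [m] ∧ m ≤ t ∧ EcdlpSolvable p a₁ a₂ a₃ a₄ a₆ xp yp xq yq m

/-- The function-class form of the crux ("no polynomial-time algorithm computes prime-field elliptic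
discrete logarithms"). [cite: Miller1986ECC, pp. 421–423] -/
def EcdlpSearchNotInFP : Prop := ¬ EcdlpSearchInFP

/-- `EcdlpHalfLanguage`: codes of `(p, a₁,…,a₆, P, Q)` such that `Q ∈ ⟨P⟩` and the LEAST logarithm `m`
lies in the lower half of the exponent range, `2m < ord P` — the Blum–Micali hard-core predicate of the
elliptic discrete logarithm as a language. [cite: BlumMicali1984, §3] -/
def EcdlpHalfLanguage : Language Bool :=
  encodingListNatBool.toLanguage {l : List ℕ | ∃ p a₁ a₂ a₃ a₄ a₆ xp yp xq yq : ℕ,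
    l = [p, a₁, a₂, a₃, a₄, a₆, xp, yp, xq, yq] ∧
      ∃ m : ℕ, EcdlpSolvable p a₁ a₂ a₃ a₄ a₆ xp yp xq yq m ∧
        (∀ m' : ℕ, m' < m → ¬ EcdlpSolvable p a₁ a₂ a₃ a₄ a₆ xp yp xq yq m') ∧
        ∃ hp : p.Prime, (haveI : Fact p.Prime := ⟨hp⟩;
          ∃ hP : (ecdlpCurve p a₁ a₂ a₃ a₄ a₆).toAffine.Nonsingular (xp : ZMod p) (yp : ZMod p),
            2 * m < addOrderOf (WeierstrassCurve.Affine.Point.some (xp : ZMod p) (yp : ZMod p) hP))}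

/-- The hard-core-bit form of the crux: `EcdlpHalfLanguage ∉ P`. `⟺ X` by `L_EC ∈ P ⇒ least log ∈ FP ⇒
half ∈ P` and Blum–Micali's interval-halving `half ∈ P ⇒ least log ∈ FP ⇒ L_EC ∈ P` (census D8). [cite: BlumMicali1984, §3] -/
def EcdlpHalfNotInP : Prop := EcdlpHalfLanguage ∉ PNPWave0.P Bool

/-- `EcdlpMembershipLanguage`: the `t = ∞` slice — codes of `(p, a₁,…,a₆, P, Q)` with `Q ∈ ⟨P⟩`
(subgroup membership in `E(𝔽_p)`). It Karp-reduces INTO `L_EC` (append `t := 4p`, a bound on `#E(𝔽_p)`),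
so its hardness is ≥ X by `ecdlpNotInP_of_karpImport` once that reduction is certified (census D9). [cite: SilvermanAEC2009, Example XI.4.1(c)] -/
def EcdlpMembershipLanguage : Language Bool :=
  encodingListNatBool.toLanguage {l : List ℕ | ∃ p a₁ a₂ a₃ a₄ a₆ xp yp xq yq : ℕ,
    l = [p, a₁, a₂, a₃, a₄, a₆, xp, yp, xq, yq] ∧ ∃ t : ℕ, EcdlpSolvable p a₁ a₂ a₃ a₄ a₆ xp yp xq yq t}

/-- Sanity: the search form and the half form are statements about the same instances as `L_EC`
(`EcdlpSolvable` is monotone in the bound, landed). [cite: SilvermanAEC2009, Example XI.4.1(c)] -/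
theorem ecdlpSolvable_mono_example {p a₁ a₂ a₃ a₄ a₆ xp yp xq yq t t' : ℕ}
    (h : EcdlpSolvable p a₁ a₂ a₃ a₄ a₆ xp yp xq yq t) (ht : t ≤ t') :
    EcdlpSolvable p a₁ a₂ a₃ a₄ a₆ xp yp xq yq t' :=
  h.mono ht

end Summit.PneNP.PneNP.Cruxes.EcdlpNotInP.StrategyCensus
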